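import Summits.RiemannHypothesis.RiemannHypothesis.Theses.RuelleBand
import Summits.RiemannHypothesis.RiemannHypothesis.Theses.Strip
import Literature.NumberTheory.LFunctions.GeneralizedRH
import Literature.Barriers.RiemannHypothesis.LindelofBacklundProofs
import Literature.NumberTheory.LFunctions.VinogradovKorobovInputs

/-! Scratch (planner crux-plan interior-edge-split): the edge stub is VERBATIM route Strip's crux and
VERBATIM the conclusion of RuelleBand's support `AsymptoticToZeroFreeStrip` (both `Iff.rfl`). -/

set_option linter.dupNamespace false

namespace Summit.RiemannHypothesis.RiemannHypothesis.Cruxes.AsymptoticCriticalLine.InteriorEdgeSplitScratch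

/-- local copy of the skeleton's `EdgeZeroFreeStrip` (same text) -/
def EdgeZeroFreeStrip : Prop :=
  ∃ δ : ℝ, 0 < δ ∧ ∀ s : ℂ, riemannZeta s = 0 → 1 - δ < s.re → s.re < 1 → False

/-- local copy of the skeleton's `NoRightInteriorBand` (same text) -/
def NoRightInteriorBand : Prop :=
  ∀ σ₀ : ℝ, 1 / 2 < σ₀ → σ₀ < 1 →
    ∃ ε : ℝ, 0 < ε ∧
      {s : ℂ | riemannZeta s = 0 ∧ 0 < s.re ∧ s.re < 1 ∧ |s.re - σ₀| < ε}.Finite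

example : EdgeZeroFreeStrip ↔ Summit.RiemannHypothesis.RiemannHypothesis.Theses.Strip.StripZeroFreeStrip :=
  Iff.rfl

example : Summit.RiemannHypothesis.RiemannHypothesis.Theses.RuelleBand.AsymptoticToZeroFreeStrip ↔
    (Summit.RiemannHypothesis.RiemannHypothesis.Theses.RuelleBand.AsymptoticCriticalLine → EdgeZeroFreeStrip) :=
  Iff.rfl

/-- the edge stub is also `∃ δ > 0, QuasiRiemannHypothesis (1 − δ)` of the Literature (definitional). -/
example : EdgeZeroFreeStrip ↔ ∃ δ : ℝ, 0 < δ ∧ Literature.NumberTheory.LFunctions.QuasiRiemannHypothesis (1 - δ) :=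
  Iff.rfl

/-- Route Strip's thesis X (`StripThesis` = quasi-RH at every σ₀ > 1/2) implies the interior stub
outright (the neighbourhood `|Re s − σ₀| < (σ₀ − 1/2)/2` is zero-free), so BOTH stubs sit below
Strip's X as well: the line is consistent with route Strip's ladder. -/
example (hX : Summit.RiemannHypothesis.RiemannHypothesis.Theses.Strip.StripThesis) : NoRightInteriorBand := by
  intro σ₀ hσ _
  refine ⟨(σ₀ - 1 / 2) / 2, by linarith, ?_⟩
  convert Set.finite_empty
  ext s
  simp only [Set.mem_setOf_eq, Set.mem_empty_iff_false, iff_false, not_and]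
  intro hz h0 h1 hs
  rw [abs_sub_lt_iff] at hs
  exact hX ((σ₀ + 1 / 2) / 2) (by linarith) s hz (by linarith [hs.2]) h1

/-- CALIBRATION (planner's observation, typed only; NOT part of the line): the interior stub ALONE
implies Backlund's zero condition `∀ σ > 1/2, N(σ,T+1) − N(σ,T) = o(log T)`, hence the Lindelöf
hypothesis by Titchmarsh's Theorem 13.5 (PROVED in tree: `Titchmarsh1986_thm13_5_holds`), given a
Richert-type bound near `σ = 1` (tree: `RichertBound A B`, e.g. Ford 2002 Thm 1 = named fact
`zeta_bound_ford`).  Argument: for fixed `σ > 1/2` and any `η > 0`, the zeros with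
`Re ρ ∈ [σ, 1 − η]` are finitely many in total (cover the compact interval by the finite-zero
neighbourhoods of the stub), so eventually absent from the window `T < Im ρ ≤ T + 1`; the zeros with
`Re ρ > 1 − η` in that window number `≤ C √η log T + C_η log log T` by MTY Lemma 4.5 / Ford Lemma 4.2
(tree: `mty_lemma_4_5`, `N(t,R) ≤ 1.3478 R^{3/2} B log t + …`, applied on `≈ 1/(2η)` discs
`|1 + it_j − ρ| ≤ 2η` covering the window); `η ↓ 0` gives `o(log T)`.  So the Lindelöf content of
the crux (`ACL ⟹ LH`) sits entirely in the INTERIOR half; the edge half (a strip near `σ = 1`) is not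
known to imply LH. -/
def InteriorImpliesBacklund : Prop :=
  ∀ A B : ℝ, 6 ≤ A → 0 ≤ B → Literature.NumberTheory.LFunctions.RichertBound A B →
    NoRightInteriorBand → Literature.Barriers.RiemannHypothesis.BacklundZeroCondition

/-- … and then Lindelöf, by the proved Theorem 13.5. -/
example (h : InteriorImpliesBacklund) {A B : ℝ} (hA : 6 ≤ A) (hB : 0 ≤ B)
    (hR : Literature.NumberTheory.LFunctions.RichertBound A B) (h1 : NoRightInteriorBand) :
    Literature.NumberTheory.LFunctions.LindelofHypothesis :=
  Literature.Barriers.RiemannHypothesis.Titchmarsh1986_thm13_5_holds.2 (h A B hA hB hR h1)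

end Summit.RiemannHypothesis.RiemannHypothesis.Cruxes.AsymptoticCriticalLine.InteriorEdgeSplitScratch
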